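import Literature.Probability.RandomPlanarGeometry.TwistedLaceCoefficient
import Mathlib.Data.Matrix.Mul
import HarnessLib

/-!
# The twisted lace expansion, I: gluing lemmas for the twisted non-backtracking walk sums

Topic `Literature/Probability/RandomPlanarGeometry`, sequel to `TwistedLaceCoefficient.lean`
(`twistedTwoPoint = G^σ_n`, `twistedLaceCoefficient = Π^σ_n`, `nbWalkFun`, `twistedWeight`).
This file is the walk layer of the TWISTED NoBLE IDENTITY
`G^σ_{n+1}(z) = Σ_λ T_σ(ι,λ) G^σ_n(z - e_λ)(λ,·) + Σ_{m=1}^{n+1} Σ_y Π^σ_m(y) G^σ_{n+1-m}(z - y)`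
(Slade 2006, (3.14), in the matrix form forced by a memory-2 reference system, cf.
Fitzner–van der Hofstad (1.24)–(1.25)), proved in `TwistedLaceExpansionIdentity.lean`: here we
show that under the two-piece splitting `ω ↦ (ω(m), ω|_{[0,m]}, ω(m + ·) - ω(m))` of
`LaceExpansionWalkSplit.lean` (`glue`, `sum_walkFun_add`)
* the twisted weight is MULTIPLICATIVE, the second piece receiving as fictitious incoming direction
  the last step of the first piece (`twistedWinding_glue`, `twistedWeight_glue`) — additivity of the
  winding at the common segment `[ω(m-1), ω(m)]` and translation invariance;
* the direction-label constraints FACTORISE (`isNBLabelled_glue_iff`);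
whence the factorisation of the constrained, weighted walk sums
(`sum_nbWalkFun_mul_K`: "the portion of the walk from time `m` onwards is independent of the
portion up to time `m`", Slade §3.2, now with `4 × 4` matrix bookkeeping), and the one-step matrix
`G^σ_1(y)(ι,λ) = T_σ(ι,λ) 𝟙[y = e_λ]` (`twistedTwoPoint_one_apply`).

## References
* G. Slade, *The Lace Expansion and its Applications*, LNM 1879 (2006), §3.2, (3.12)–(3.14).
* R. Fitzner, R. van der Hofstad, *Generalized approach to the non-backtracking lace expansion*,
  PTRF 169 (2017), §1.2.2–1.3.
-/

noncomputable section

open Finset Literature.Probability.LatticeModels Literature.Probability.RandomPlanarGeometry.SAW.Zd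
open scoped BigOperators

namespace Literature.Probability.RandomPlanarGeometry.LaceExpansion

/-! ### The four directions and adjacency -/

/-- `stepDir` is injective. [folklore] -/
theorem stepDir_injective : Function.Injective stepDir := by
  intro a b h
  have h0 := congrFun h 0
  have h1 := congrFun h 1
  fin_cases a <;> fin_cases b <;> simp [stepDir] at h0 h1 ⊢

/-- Adjacency in `ℤ²`: `x ∼ y` iff `y - x` is one of the four unit vectors `stepDir λ`. [folklore] -/
theorem adj_iff_exists_stepDir (x y : Site 2) :
    (zdGraph 2).Adj x y ↔ ∃ l : Fin 4, y - x = stepDir l := by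
  rw [zdGraph_adj_iff_sub]
  constructor
  · rintro ⟨i, h | h⟩
    · fin_cases i
      · exact ⟨0, by rw [h]; ext j; fin_cases j <;> simp [stepDir]⟩
      · exact ⟨1, by rw [h]; ext j; fin_cases j <;> simp [stepDir]⟩
    · fin_cases i
      · exact ⟨2, by rw [← neg_sub, h]; ext j; fin_cases j <;> simp [stepDir]⟩
      · exact ⟨3, by rw [← neg_sub, h]; ext j; fin_cases j <;> simp [stepDir]⟩
  · rintro ⟨l, hl⟩
    fin_cases l
    · exact ⟨0, Or.inl (by rw [hl]; ext j; fin_cases j <;> simp [stepDir])⟩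
    · exact ⟨1, Or.inl (by rw [hl]; ext j; fin_cases j <;> simp [stepDir])⟩
    · exact ⟨0, Or.inr (by rw [← neg_sub, hl]; ext j; fin_cases j <;> simp [stepDir])⟩
    · exact ⟨1, Or.inr (by rw [← neg_sub, hl]; ext j; fin_cases j <;> simp [stepDir])⟩

/-- A sum over the four directions of a quantity supported on "`v = stepDir λ`" has exactly one
term when `v` is a unit vector. [folklore] -/
theorem sum_ite_eq_stepDir {M : Type*} [AddCommMonoid M] {v : Site 2} {l₀ : Fin 4}
    (hv : v = stepDir l₀) (b : Fin 4 → M) :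
    (∑ l : Fin 4, if v = stepDir l then b l else 0) = b l₀ := by
  have : ∀ l : Fin 4, (v = stepDir l) = (l = l₀) := fun l => by
    rw [hv]
    exact propext ⟨fun h => (stepDir_injective h).symm, fun h => h ▸ rfl⟩
  simp_rw [this, Finset.sum_ite_eq', Finset.mem_univ, if_true]

/-- The last step of an `m`-step walk (`m ≥ 1`) is a unit vector. [folklore] -/
theorem exists_lastStep {m : ℕ} (hm : 1 ≤ m) {y : Site 2} {ω : ℕ → Site 2}
    (hω : ω ∈ walkFun 2 m y) : ∃ l : Fin 4, ω m - ω (m - 1) = stepDir l := by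
  obtain ⟨-, -, hadj⟩ := mem_walkFun.1 hω
  have h := hadj (m - 1) (by omega)
  rw [show m - 1 + 1 = m by omega] at h
  exact (adj_iff_exists_stepDir _ _).1 h

/-! ### Windings: additivity at a common segment and translation invariance -/

/-- Additivity of the winding at a common segment `[x, y]`. [folklore] -/
theorem winding_append_cons_cons' : ∀ (l₁ : List ℂ) (x y : ℂ) (l₂ : List ℂ),
    winding (l₁ ++ x :: y :: l₂) = winding (l₁ ++ [x, y]) + winding (x :: y :: l₂)
  | [], x, y, l₂ => by simp
  | [z], x, y, l₂ => by simp
  | z :: z' :: l₁, x, y, l₂ => by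
    have ih := winding_append_cons_cons' (z' :: l₁) x y l₂
    rcases l₁ with _ | ⟨z'', l₁⟩
    · simp only [List.cons_append, List.nil_append, winding_cons_cons_cons] at ih ⊢
      rw [ih]; ring
    · simp only [List.cons_append, winding_cons_cons_cons] at ih ⊢
      rw [ih]; ring

/-- The turning angle is translation invariant. [folklore] -/
theorem turning_add_const (a b c μ : ℂ) : turning (a + μ) (b + μ) (c + μ) = turning a b c := by
  simp [turning]

/-- The winding is translation invariant. [folklore] -/
theorem winding_map_add_const (μ : ℂ) : ∀ (l : List ℂ), winding (l.map (· + μ)) = winding l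
  | [] => by simp
  | [_] => by simp
  | [_, _] => by simp
  | a :: b :: c :: l => by
    have ih := winding_map_add_const μ (b :: c :: l)
    simp only [List.map_cons] at ih ⊢
    rw [winding_cons_cons_cons, winding_cons_cons_cons, ih, turning_add_const]

/-! ### The one-step matrix `G^σ_1 = D` -/

/-- The one-step walk from `0` to `y`, as a vertex function frozen at `y`. [folklore] -/
def oneStep (y : Site 2) : ℕ → Site 2 := fun i => if i = 0 then 0 else y

/-- `𝒲_1(0,y) = {oneStep y}` if `y ∼ 0`. [folklore] -/
theorem mem_walkFun_one_iff {y : Site 2} {ω : ℕ → Site 2} :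
    ω ∈ walkFun 2 1 y ↔ ω = oneStep y ∧ (zdGraph 2).Adj 0 y := by
  constructor
  · intro h
    obtain ⟨h0, hend, hadj⟩ := mem_walkFun.1 h
    have hω : ω = oneStep y := by
      funext i
      rcases Nat.eq_zero_or_pos i with rfl | hi
      · rw [h0]; rfl
      · rw [hend i hi, oneStep, if_neg (by omega)]
    refine ⟨hω, ?_⟩
    have := hadj 0 Nat.one_pos
    rwa [h0, hend 1 le_rfl] at this
  · rintro ⟨rfl, hadj⟩
    refine mem_walkFun.2 ⟨rfl, fun i hi => if_neg (by omega), fun i hi => ?_⟩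
    have : i = 0 := by omega
    subst this
    simpa [oneStep] using hadj

/-- The twisted winding of the one step `e_λ` with incoming direction `ι` is the turning angle
`θ(ι,λ) = turning (-e_ι) 0 e_λ`. [folklore] -/
theorem twistedWinding_oneStep (ι : Fin 4) (y : Site 2) :
    twistedWinding ι 1 (oneStep y) = turning (-Site.toComplex (stepDir ι)) 0 (Site.toComplex y) := by
  have hzero : Site.toComplex (0 : Site 2) = 0 := Complex.ext (by simp) (by simp)
  simp [twistedWinding, LaceExpansion.polyline, oneStep, List.range_succ, hzero]

/-- **`G^σ_1 = D`**: `G^σ_1(y)(ι,λ) = T_σ(ι,λ) 𝟙[y = e_λ]` — the one-step twisted two-point matrix is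
the twisted step matrix placed at the four neighbours of the origin (a first step reversing the
fictitious incoming step is excluded on both sides). [cite: Slade2006LaceExpansion, §3.2 (the term `c₁ = |Ω|D` of (3.14))] -/
theorem twistedTwoPoint_one_apply (σ : ℝ) (y : Site 2) (ι l : Fin 4) :
    twistedTwoPoint σ 1 y ι l = if y = stepDir l then twistedStepMatrix σ ι l else 0 := by
  rw [twistedTwoPoint, Matrix.of_apply, if_neg one_ne_zero]
  by_cases hy : y = stepDir l
  · subst hy
    rw [if_pos rfl, twistedStepMatrix, Matrix.of_apply]
    by_cases hrev : stepDir l = -stepDir ι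
    · -- reversal of the fictitious step: no admissible walk, and `T_σ(ι,λ) = 0`
      rw [if_pos hrev]
      refine Finset.sum_eq_zero fun ω hω => ?_
      rw [nbWalkFun, Finset.mem_filter, mem_walkFun_one_iff] at hω
      obtain ⟨⟨rfl, -⟩, h1, -, -⟩ := hω
      exact absurd (by rw [oneStep, if_neg one_ne_zero, hrev]) h1
    · rw [if_neg hrev]
      have hset : nbWalkFun ι l 1 (stepDir l) = {oneStep (stepDir l)} := by
        ext ω
        rw [nbWalkFun, Finset.mem_filter, mem_walkFun_one_iff, Finset.mem_singleton, IsNBLabelled]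
        constructor
        · rintro ⟨⟨h, -⟩, -⟩; exact h
        · rintro rfl
          refine ⟨⟨rfl, (adj_iff_exists_stepDir 0 _).2 ⟨l, by rw [sub_zero]⟩⟩, ?_, by simp, ?_⟩
          · rw [oneStep, if_neg one_ne_zero]; exact hrev
          · simp [oneStep]
      have hK : K (interaction 1 (oneStep (stepDir l))) 0 1 = 1 := by
        rw [K]
        refine Finset.prod_eq_one fun e he => ?_
        rw [mem_edges] at he
        have h1 : e.1 = 0 := by omega
        have h2 : e.2 = 1 := by omega
        have hne : oneStep (stepDir l) 0 ≠ oneStep (stepDir l) 1 := by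
          rw [oneStep, oneStep, if_pos rfl, if_neg one_ne_zero]
          intro h
          have h₀ := congrFun h 0
          have h₁ := congrFun h 1
          fin_cases l <;> simp [stepDir] at h₀ h₁
        rw [interaction, h1, h2, if_neg hne]
        ring
      rw [hset, Finset.sum_singleton, twistedWeight, twistedWinding_oneStep, hK]
      push_cast
      ring
  · rw [if_neg hy]
    refine Finset.sum_eq_zero fun ω hω => ?_
    rw [nbWalkFun, Finset.mem_filter, mem_walkFun_one_iff] at hω
    obtain ⟨⟨rfl, -⟩, -, -, hlast⟩ := hω
    exact absurd (by simpa [oneStep] using hlast) hy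

/-! ### Gluing: the twisted weight is multiplicative, the label constraints factorise -/

section Glue

variable {m l : ℕ} {ι lam κ : Fin 4} {y x : Site 2} {ω₁ ω₂ : ℕ → Site 2}

/-- `J[0,m]` of a glued walk sees only `ω₁`. [folklore] -/
theorem J_glue_of_le (lam' : ℝ) (m : ℕ) (v : Site 2) (ω₁ ω₂ : ℕ → Site 2) :
    J (interaction lam' (glue m v ω₁ ω₂)) 0 m = J (interaction lam' ω₁) 0 m :=
  J_congr fun s t _ hst htm => by
    simp only [interaction, glue_of_le (hst.le.trans htm), glue_of_le htm]

/-- **Additivity of the twisted winding under gluing**: if the first piece `ω₁` (`m ≥ 1` steps,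
ending at `y`) has last step `e_λ` and `ω₂` starts at `0`, the winding of the glued walk with
incoming direction `ι` is the winding of `ω₁` with incoming direction `ι` plus the winding of `ω₂`
with incoming direction `λ` (split the polyline at the segment `[ω(m-1), ω(m)]`, which is the
fictitious first segment `[-e_λ + y, y]` of the translated second piece). [folklore] -/
theorem twistedWinding_glue (hm : 1 ≤ m) (h1 : ω₁ m = y) (hlast : ω₁ m - ω₁ (m - 1) = stepDir lam)
    (h2 : ω₂ 0 = 0) (l : ℕ) :
    twistedWinding ι (m + l) (glue m y ω₁ ω₂) = twistedWinding ι m ω₁ + twistedWinding lam l ω₂ := by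
  -- `Site.toComplex` is additive (local copies; the landed versions live in heavy modules)
  have hadd : ∀ a b : Site 2, Site.toComplex (a + b) = Site.toComplex a + Site.toComplex b :=
    fun a b => Complex.ext (by simp) (by simp)
  have hsub : ∀ a b : Site 2, Site.toComplex (a - b) = Site.toComplex a - Site.toComplex b :=
    fun a b => Complex.ext (by simp) (by simp)
  have hzero : Site.toComplex (0 : Site 2) = 0 := Complex.ext (by simp) (by simp)
  obtain ⟨k, rfl⟩ : ∃ k, m = k + 1 := ⟨m - 1, by omega⟩
  -- the glued polyline, split as `(-e_ι :: ω[0,k)) ++ (ω(k) :: ω(k+1) :: ω(k+2, …))`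
  set F : ℕ → ℂ := fun i => Site.toComplex (glue (k + 1) y ω₁ ω₂ i) with hF
  have hrange : List.range (k + 1 + l + 1) = List.range k ++ k :: (k + 1) :: (List.range l).map (k + 2 + ·) := by
    rw [show k + 1 + l + 1 = (k + 2) + l by omega, List.range_add,
      show k + 2 = k + 1 + 1 from rfl, List.range_succ, List.range_succ]
    simp
  have hpoly : (-Site.toComplex (stepDir ι)) :: polyline (k + 1 + l) (glue (k + 1) y ω₁ ω₂) =
      ((-Site.toComplex (stepDir ι)) :: (List.range k).map F) ++
        F k :: F (k + 1) :: ((List.range l).map (k + 2 + ·)).map F := by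
    simp only [LaceExpansion.polyline, hrange, List.map_append, List.map_cons, List.cons_append, hF]
  -- first piece
  have hfirst : ((-Site.toComplex (stepDir ι)) :: (List.range k).map F) ++ [F k, F (k + 1)] =
      (-Site.toComplex (stepDir ι)) :: polyline (k + 1) ω₁ := by
    have hr : List.range (k + 1 + 1) = List.range k ++ [k, k + 1] := by
      rw [List.range_succ, List.range_succ]; simp
    simp only [LaceExpansion.polyline, hr, List.map_append, List.map_cons, List.map_nil,
      List.cons_append]
    congr 1
    congr 1
    · refine List.map_congr_left fun i hi => ?_
      rw [List.mem_range] at hi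
      simp only [hF, glue_of_le (show i ≤ k + 1 by omega)]
    · simp only [hF, glue_of_le (Nat.le_succ k), glue_of_le le_rfl]
  -- second piece: the translate by `y` of `-e_λ :: polyline l ω₂`
  have hk : ω₁ k = y - stepDir lam := by
    rw [show k = k + 1 - 1 by omega, ← h1]
    rw [Nat.add_sub_cancel] at hlast ⊢
    rw [← hlast]; abel
  have hsecond : F k :: F (k + 1) :: ((List.range l).map (k + 2 + ·)).map F =
      ((-Site.toComplex (stepDir lam)) :: polyline l ω₂).map (· + Site.toComplex y) := by
    simp only [LaceExpansion.polyline, List.map_cons, List.map_map, hF]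
    rw [List.range_succ_eq_map, List.map_cons, List.map_map]
    congr 1
    · rw [glue_of_le (Nat.le_succ k), hk, hsub]; ring
    congr 1
    · simp only [Function.comp_apply]
      rw [glue_of_le le_rfl, h1, h2, hzero, zero_add]
    · refine List.map_congr_left fun i _ => ?_
      simp only [Function.comp_apply, Nat.succ_eq_add_one]
      rw [show k + 2 + i = (k + 1) + (i + 1) by omega, glue_add h1 h2, hadd]
  rw [twistedWinding, hpoly, winding_append_cons_cons', hfirst, hsecond, winding_map_add_const]
  rfl

/-- **Multiplicativity of the twisted weight under gluing** (same hypotheses). [folklore] -/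
theorem twistedWeight_glue (σ : ℝ) (hm : 1 ≤ m) (h1 : ω₁ m = y)
    (hlast : ω₁ m - ω₁ (m - 1) = stepDir lam) (h2 : ω₂ 0 = 0) (l : ℕ) :
    twistedWeight σ ι (m + l) (glue m y ω₁ ω₂) = twistedWeight σ ι m ω₁ * twistedWeight σ lam l ω₂ := by
  rw [twistedWeight, twistedWeight, twistedWeight, twistedWinding_glue hm h1 hlast h2, ← Complex.exp_add]
  congr 1
  push_cast
  ring

/-- **The label constraints factorise under gluing**: for `ω₁ ∈ 𝒲_m(0,y)` with last step `e_λ`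
and `ω₂ ∈ 𝒲_l(0,x)` (`m, l ≥ 1`), the glued walk is non-backtracking with incoming direction `ι`
and last step `e_κ` iff `ω₁` is so with labels `(ι, λ)` and `ω₂` with labels `(λ, κ)` — the
coupling across the cut, `ω(m+1) ≠ ω(m-1)`, is exactly the fictitious-step condition of the second
piece. [folklore] -/
theorem isNBLabelled_glue_iff (hm : 1 ≤ m) (hl : 1 ≤ l) (hω₁ : ω₁ ∈ walkFun 2 m y)
    (hlast : ω₁ m - ω₁ (m - 1) = stepDir lam) (hω₂ : ω₂ ∈ walkFun 2 l x) :
    IsNBLabelled ι κ (m + l) (glue m y ω₁ ω₂) ↔ IsNBLabelled ι lam m ω₁ ∧ IsNBLabelled lam κ l ω₂ := by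
  obtain ⟨-, h1end, -⟩ := mem_walkFun.1 hω₁
  obtain ⟨h20, -, -⟩ := mem_walkFun.1 hω₂
  have h1 : ω₁ m = y := h1end m le_rfl
  have hg_le : ∀ i, i ≤ m → glue m y ω₁ ω₂ i = ω₁ i := fun i hi => glue_of_le hi
  have hg_add : ∀ j, glue m y ω₁ ω₂ (m + j) = ω₂ j + y := fun j => glue_add h1 h20 j
  have hkm : ω₁ (m - 1) = y - stepDir lam := by
    rw [← h1, ← hlast]; abel
  simp only [IsNBLabelled, Finset.mem_range]
  rw [hg_le 1 hm, show m + l - 1 = m + (l - 1) by omega, hg_add,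
    hg_add, add_sub_add_right_eq_sub]
  constructor
  · rintro ⟨hι, hnb, hκ⟩
    refine ⟨⟨hι, fun i hi => ?_, hlast⟩, ?_, fun j hj => ?_, hκ⟩
    · have := hnb i (by omega)
      rwa [hg_le (i + 2) (by omega), hg_le i (by omega)] at this
    · -- the coupling across the cut
      have := hnb (m - 1) (by omega)
      rw [show m - 1 + 2 = m + 1 by omega, hg_add, hg_le (m - 1) (by omega), hkm] at this
      intro h
      exact this (by rw [h]; abel)
    · have := hnb (m + j) (by omega)
      rwa [show m + j + 2 = m + (j + 2) by omega, hg_add, hg_add, Ne, add_left_inj] at this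
  · rintro ⟨⟨hι, hnb₁, -⟩, hfict, hnb₂, hκ⟩
    refine ⟨hι, fun i hi => ?_, hκ⟩
    rcases lt_trichotomy (i + 2) (m + 1) with hlt | heq | hgt
    · rw [hg_le (i + 2) (by omega), hg_le i (by omega)]
      exact hnb₁ i (by omega)
    · have him : i = m - 1 := by omega
      subst him
      rw [show m - 1 + 2 = m + 1 by omega, hg_add, hg_le (m - 1) (by omega), hkm]
      intro h
      apply hfict
      have := congrArg (· - y) h
      simpa using this
    · obtain ⟨j, rfl⟩ : ∃ j, i = m + j := ⟨i - m, by omega⟩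
      rw [show m + j + 2 = m + (j + 2) by omega, hg_add, hg_add, Ne, add_left_inj]
      exact hnb₂ j (by omega)

end Glue

/-! ### Factorisation of the constrained, weighted walk sums at time `m` -/

/-- The two-piece factorisation of walk sums (`sum_walkFun_add`) for complex-valued functionals.
[cite: Slade2006LaceExpansion, §3.2 (the factorisation behind (3.14))] -/
theorem sum_walkFun_add_complex {d : ℕ} (m l : ℕ) (x : Site d) (f : (ℕ → Site d) → ℂ) :
    ∑ ω ∈ walkFun d (m + l) x, f ω =
      ∑ v ∈ box d m, ∑ ω₁ ∈ walkFun d m v, ∑ ω₂ ∈ walkFun d l (x - v), f (glue m v ω₁ ω₂) := by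
  apply Complex.ext
  · rw [Complex.re_sum, sum_walkFun_add m l x (fun ω => (f ω).re)]
    simp only [Complex.re_sum]
  · rw [Complex.im_sum, sum_walkFun_add m l x (fun ω => (f ω).im)]
    simp only [Complex.im_sum]

/-- **Factorisation at time `m` of the twisted, direction-labelled walk sums** ("the portion of the
walk from time `m` onwards is independent of the portion up to time `m`", with the memory-2 weight
and the non-backtracking constraint coupled across the cut only through the label `λ` = last step
of the first piece = fictitious incoming step of the second): for `m, l ≥ 1` and a real functional
`Φ` of `ω|_{[0,m]}`,
`Σ_{ω ∈ 𝒲ᴺᴮ_{m+l}(0,z)_{ι,κ}} e^{-iσW_ι(ω)} Φ(ω) K[m,m+l](ω)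
  = Σ_y Σ_λ (Σ_{ω₁ ∈ 𝒲ᴺᴮ_m(0,y)_{ι,λ}} e^{-iσW_ι(ω₁)} Φ(ω₁)) · G^σ_l(z - y)(λ,κ)`.
[cite: Slade2006LaceExpansion, §3.2 (derivation of (3.14))] -/
theorem sum_nbWalkFun_mul_K (σ : ℝ) {m l : ℕ} (hm : 1 ≤ m) (hl : 1 ≤ l) (z : Site 2) (ι κ : Fin 4)
    (Φ : (ℕ → Site 2) → ℝ) (hΦ : ∀ (v : Site 2) (ω₁ ω₂ : ℕ → Site 2), Φ (glue m v ω₁ ω₂) = Φ ω₁) :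
    ∑ ω ∈ nbWalkFun ι κ (m + l) z,
        twistedWeight σ ι (m + l) ω * ((Φ ω * K (interaction 1 ω) m (m + l) : ℝ) : ℂ) =
      ∑ y ∈ box 2 m, ∑ lam : Fin 4,
        (∑ ω₁ ∈ nbWalkFun ι lam m y, twistedWeight σ ι m ω₁ * (Φ ω₁ : ℂ)) *
          twistedTwoPoint σ l (z - y) lam κ := by
  have hl0 : l ≠ 0 := by omega
  rw [nbWalkFun, Finset.sum_filter, sum_walkFun_add_complex]
  refine Finset.sum_congr rfl fun y _ => ?_
  simp only [twistedTwoPoint, Matrix.of_apply, if_neg hl0, nbWalkFun, Finset.sum_filter,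
    Finset.sum_mul_sum]
  -- both sides are now sums over `ω₁ ∈ 𝒲_m(0,y)`, `ω₂ ∈ 𝒲_l(0,z-y)`; compare termwise
  calc ∑ ω₁ ∈ walkFun 2 m y, ∑ ω₂ ∈ walkFun 2 l (z - y),
        (if IsNBLabelled ι κ (m + l) (glue m y ω₁ ω₂) then
          twistedWeight σ ι (m + l) (glue m y ω₁ ω₂) *
            ((Φ (glue m y ω₁ ω₂) * K (interaction 1 (glue m y ω₁ ω₂)) m (m + l) : ℝ) : ℂ) else 0)
      = ∑ ω₁ ∈ walkFun 2 m y, ∑ ω₂ ∈ walkFun 2 l (z - y), ∑ lam : Fin 4,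
          (if IsNBLabelled ι lam m ω₁ then twistedWeight σ ι m ω₁ * (Φ ω₁ : ℂ) else 0) *
            (if IsNBLabelled lam κ l ω₂ then
              twistedWeight σ lam l ω₂ * ((K (interaction 1 ω₂) 0 l : ℝ) : ℂ) else 0) := by
        refine Finset.sum_congr rfl fun ω₁ hω₁ => Finset.sum_congr rfl fun ω₂ hω₂ => ?_
        obtain ⟨lam₀, hlast⟩ := exists_lastStep hm hω₁
        obtain ⟨-, h1end, -⟩ := mem_walkFun.1 hω₁
        obtain ⟨h20, -, -⟩ := mem_walkFun.1 hω₂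
        have h1 : ω₁ m = y := h1end m le_rfl
        have hiff := isNBLabelled_glue_iff (ι := ι) (κ := κ) hm hl hω₁ hlast hω₂
        rw [Finset.sum_eq_single lam₀]
        · by_cases hP₁ : IsNBLabelled ι lam₀ m ω₁
          · by_cases hP₂ : IsNBLabelled lam₀ κ l ω₂
            · rw [if_pos (hiff.2 ⟨hP₁, hP₂⟩), if_pos hP₁, if_pos hP₂,
                twistedWeight_glue σ hm h1 hlast h20, hΦ, K_glue_add 1 h1 h20]
              push_cast
              ring
            · rw [if_neg (fun h => hP₂ (hiff.1 h).2), if_neg hP₂, mul_zero]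
          · rw [if_neg (fun h => hP₁ (hiff.1 h).1), if_neg hP₁, zero_mul]
        · intro lam _ hne
          rw [if_neg, zero_mul]
          rintro ⟨-, -, hlam⟩
          exact hne (stepDir_injective (hlam.symm.trans hlast))
        · intro h; exact absurd (Finset.mem_univ lam₀) h
    _ = ∑ lam : Fin 4, ∑ ω₁ ∈ walkFun 2 m y, ∑ ω₂ ∈ walkFun 2 l (z - y),
          (if IsNBLabelled ι lam m ω₁ then twistedWeight σ ι m ω₁ * (Φ ω₁ : ℂ) else 0) *
            (if IsNBLabelled lam κ l ω₂ then
              twistedWeight σ lam l ω₂ * ((K (interaction 1 ω₂) 0 l : ℝ) : ℂ) else 0) := by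
        rw [Finset.sum_congr rfl fun ω₁ _ => Finset.sum_comm]
        exact Finset.sum_comm

end Literature.Probability.RandomPlanarGeometry.LaceExpansion
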